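import Literature.NumberTheory.Automorphic.QuaternionOrderHeckeJacquetLanglands
import Literature.NumberTheory.Automorphic.QuaternionOrderResidueStrongApproximation
import Literature.NumberTheory.EllipticCurves.GlobalMinimalModel
import Literature.RepresentationTheory.FiniteGroups.GL2ModularPrincipalSeries
import HarnessLib

/-!
# The tame principal-series TYPE, seen by `SL₂(𝔽_q)`, of the cover span of a Cartan-level quaternionic eigenform at a
# tame cubic place (Jacquet–Langlands, local–global compatibility at `q`, the `K(q)`-type of a tamely ramified principal
# series, strong approximation)

Topic `Literature/NumberTheory/Automorphic`, namespace `Literature.NumberTheory.Automorphic`.  ONE NAMED FACT (`def … : Prop`,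
D-0014: a published chain, cited to the places that prove each link, asserted nowhere, no `sorry`, no instance, no notation),
COMPOSITE-SOURCED (no single numbered print states it; placement: bsd-stepL referee g96 `PLACEMENT-FTYPE` (F-a), conditions (c1)–(c3),
booked by director-bsd (985)(a)).  It is the non-split-Cartan ∕ quaternionic twin — seen by `SL₂(𝔽_q)` only — of the tree's accepted split fact
`Literature.NumberTheory.EllipticCurves.fullLevelHomology_isIsotypic_tamePrincipalSeries_of_central` (same print chain, minus
Eichler–Shimura: here the forms are holomorphic and no homology ∕ ordinarity enters).

THE OBJECTS (all in the tree).  A Cartan datum `X : CartanLevelCurveData D M C` (`ShimuraCurveCartanLevel`): an indefinite quaternion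
algebra `X.B/ℚ` of discriminant `D` with a real splitting `X.ι`, a maximal order `X.O₀` and the level order `X.O` (Eichler of level `M`,
non-split Cartan at the primes of `C`), its Fuchsian group `X.Gamma = ι(O¹)`, cusp forms `CuspForm X.Gamma 2` and the Hecke operators
`X.heckeFun ℓ` at good primes.  For `q ∈ C` the COVER ORDER `O' = X.O + (∏_{p ∈ C∖q} p)·X.O₀` (equal to `X.O` off `q`, MAXIMAL at `q`;
hypothesis `hO'`, in the tree `CartanCover.isOrder_coverOrder`) with norm-one group `Γ' = normOneUnits X.ι hO'`, and a RESIDUE MODEL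
`red : O' → M₂(𝔽_q)` (a surjective ring map with kernel `qO'` and `det ∘ red = nrd mod q`, the idiom of
`exists_reducedNorm_eq_one_map_eq_of_det_eq_one`).  The principal series `Ind_B^{GL₂(𝔽_q)}(χ₁ ⊠ χ₂)` of `GL₂(𝔽_q)` in the function model is
`GL2.principalSeriesRep (ZMod q) χ₁ χ₂` (`GL2ModularPrincipalSeries`, Bump §4.1 (1.6)): the functions `f : GL₂(𝔽_q) → ℂ` with
`f(bx) = χ₁(b₀₀)χ₂(b₁₁)f(x)`, carrier `Representation.coindV (GL2.borel _).subtype (scalarRep (GL2.borelCharacter _ χ₁ χ₂))`, right translation.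

THE FACT `cartanCoverSpan_isIsotypic_tamePrincipalSeries`.  Let `V/ℚ` be elliptic of conductor `N = D·M·∏_{p∈C} p²` with `q³ ∤ N` and
`3 ∣ c_q(V)` at a Cartan place `q ∈ C`, `q ≡ 1 (mod 3)`, and let `F₀ ∈ S₂(X.Γ)` be a non-zero `a_ℓ(V)`-eigenform of the `X.heckeFun ℓ` (good `ℓ`).
Then the `ℂ`-span `S` of the slashes `F₀ ∣[2] γ`, `γ ∈ Γ'`, with `Γ'` acting through `red`, is — as a `ℂ[SL₂(𝔽_q)]`-module — a direct sum of
copies of `Res_{SL₂(𝔽_q)} Ind_B^{GL₂(𝔽_q)}(χ ⊠ χ⁻¹)` for a character `χ` of `𝔽_qˣ` of exact order `3`: there are `χ` (`χ³ = 1`, `χ ≠ 1`), `k` and a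
`ℂ`-linear `Φ : (ℍ → ℂ) → (Fin k → (GL₂(𝔽_q) → ℂ))`, injective on `S`, whose values on `S` are exactly the `k`-tuples of functions of the model,
with `Φ (G ∣[2] γ) = ((i, y) ↦ Φ G i (y · ḡ⁻¹))`, `ḡ = red γ` (right translation by `ḡ⁻¹`, the orientation making `Φ` a module map for
`s·G := G ∣[2] γ_{s⁻¹}`).  In words: **the `f_V`-part of the weight-2 forms on the full-level-`q` cover `ι(O'¹ ∩ (1 + qO'))`, generated by a
Cartan-level eigenvector, is isotypic of SL₂-type `Ind_{B₁}^{SL₂(𝔽_q)}(ε̄²)`, `ε̄` cubic.**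

WHY IT IS TRUE (the printed chain; each link is cited on the declaration):
(1) `q ∈ C`, `q ≡ 1 (3)` prime ⇒ `q ≥ 7`, `q² ∥ N` (additive); Tate's algorithm gives `c_q ∈ {1,2,3,4}` at additive places and
    `c_q = 3 ⟺` Kodaira `IV ∕ IV*` `⟺ v_q(Δ_min) ∈ {4, 8}` ⟺ semistability defect `e = 12/gcd(12, v_q(Δ_min)) = 3` [Tate1975Algorithm];
    the image of inertia `Φ_q` is cyclic of order `e = 3 ∣ q − 1` [Serre1972PointsOrdreFini, §5.6 p. 312], so `ρ_V|_{I_q} ≅ ε ⊕ ε⁻¹` with `ε`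
    tame of exact order `3` (`det ρ_V|_{I_q} = 1`, the `ℓ`-adic cyclotomic character being unramified at `q`), and `μ₃ ⊂ ℚ_q` makes the
    inertia field abelian over `ℚ_q`: `WD(ρ_V|_{G_q}) = μ₁ε ⊕ μ₂ε⁻¹`, i.e. `π_{V,q} = PS(μ₁ε, μ₂ε⁻¹)` by local–global compatibility at the ramified
    place `q` [Carayol1986ASENS, Thm. (A)].
(2) `K(q)`-invariants of a tamely ramified principal series: `PS(χ₁, χ₂)^{K(q)} ≅ I(χ̄₁, χ̄₂) = Ind_B^{GL₂(𝔽_q)}(χ̄₁ ⊠ χ̄₂)` for `χ̄₁ ≠ χ̄₂`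
    [ConradDiamondTaylor1999, Lemma 4.2.4 (2), p. 538] [Casselman1973, Thm. 1]; here `χ̄₁ = ε̄`, `χ̄₂ = ε̄⁻¹`, `ε̄ ≠ ε̄⁻¹`.
(3) Jacquet–Langlands and strong multiplicity one: the `a_ℓ(V)`-eigenform `F₀` on the one-component, `det`-surjective level `X.Γ` (trivial
    central character) generates `π' = JL(π_{f_V})` on `B^×(𝔸)`, `π'_q ≅ π_{V,q}` (`q ∤ D`) [Gelbart1975, Thm. 10.1 and Thm. 10.2 (§10)]
    [JacquetLanglands1970, Thm. 16.1].
(4) Adelic–classical dictionary for the cover (no Eichler–Shimura): weight-2 forms on `B^×` of level `K^q·K(q)`, `K(q) = 1 + qO'_q`, form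
    `Ind_{SL₂(𝔽_q)}^{GL₂(𝔽_q)} S₂(Γ'(q))` (components `↔ Ẑˣ/nrd K = (ℤ/q)ˣ`), and right translation by `s̃ ∈ O'_qˣ` of residue `s ∈ SL₂(𝔽_q)`
    restricted to the identity component is `F ↦ F ∣[2] γ_s⁻¹` for any `γ_s ∈ O'¹` with `red γ_s = s` — strong approximation for `O'¹`
    [VignerasLNM800, Ch. III §4 Thm. 4.3 and §5 Cor. 5.7] (tree: `exists_reducedNorm_eq_one_map_eq_of_det_eq_one`); `Γ'(q) ⊆ ι(O¹) = X.Γ`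
    because `qO' ⊆ O`, so `Γ'` acts on `S` through `red`.
(5) Hence `S` is the image, under an `SL₂(𝔽_q)`-equivariant map, of `ℂ[SL₂(𝔽_q)]·φ₀ ⊆ A(K^q K(q))[π'] ≅ (π'_q)^{K(q)} ⊗ ℂ^m`, so it is isotypic
    of type `Res_{SL₂(𝔽_q)} I(ε̄, ε̄⁻¹) = Ind_{B₁}^{SL₂(𝔽_q)}(ε̄²)` (one double coset `GL₂ = B·SL₂`), IRREDUCIBLE since `(ε̄²)² = ε̄ ≠ 1`
    [Bump1997, §4.1 Thm. 4.1.1 p. 406]; by Maschke `S ≅ (Res Ind(ε̄ ⊠ ε̄⁻¹))^{⊕k}`, which is the displayed `Φ`.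

WHAT IS DELIBERATELY NOT HERE.  Not the `GL₂(𝔽_q)`-type: the classical slash span sees `Γ' ⊂` norm one, hence `SL₂(𝔽_q)` only, and
`Res_{SL₂} I(ε̄₃, ε̄₃⁻¹) ≅ Res_{SL₂} I(ε̄₆, ε̄₆⁻¹)` — the `det`-sensitive type lives on the induced ∕ adelic model.  No multiplicity (`k`) is
asserted; nothing at `q ≡ 2 (3)` (cuspidal type `Θ(ν)`, [ConradDiamondTaylor1999, Lemma 4.2.4 (3)]); nothing for `3 ∤ c_q`.
TODO(general form): the same for any eigenform whose local type at `q` is a tame principal series `I(χ̄₁, χ̄₂)`, `χ̄₁ ≠ χ̄₂` — as for the split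
sibling, the tree has no vocabulary for «the local type at `q`» on the classical side, so the elliptic-curve case is stated.

Consumer: route BSD/ClassRecordThree (and KolyvaginRoadThree by signature), crux NUM `CartanOnePlaceDegreeLawAtThree` (stmt-BirchSwinnertonDyer-24801),
line `jacquet`, stub `stub_unipotentFixedInSpan` = the Theorems-side carrier `CartanCover.CartanCoverUnipotentFixedInSpan` (JVᴸ), which follows from
this fact by Bump's Lemma 4.1.1 in the tree (`GL2.deltaBorel_ne_zero`, `GL2.principalSeriesRep_upperUnip_deltaBorel`) — Theorems file
`ClassRecordThreeCartanCoverSpanTypeGlue` (`CartanCover.unipotentFixedInSpan_of_spanTamePSType`).  A named fact is a named-print DEBT (D-0026),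
not a theorem: nothing is proved about any curve by this file.

## References (page locators: CDT pp. 538 / 540–541 page-checked on the held copy by the bsd-stepL referee, bank `referee/PLACEMENT-JVL-g96.md`,
`PLACEMENT-FTYPE-g96.md`; Casselman 1973 via the witnesses W1/W2 of `referee/PLACEMENT-JVL-g96-add1.md` while acq-15072 is open — RE-CHECK Thm. 1
against the primary on fulfilment; the others as cited in the sibling file and in `QuaternionOrderHeckeJacquetLanglands`)

* B. Conrad, F. Diamond, R. Taylor, *Modularity of certain potentially Barsotti–Tate Galois representations*, J. Amer. Math. Soc. 12 (1999),
  Lemma 4.2.4 p. 538 (held: `paper:doi-10-1090-s0894-0347-99-00287-8` p0018). [ConradDiamondTaylor1999]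
* W. Casselman, *On some results of Atkin and Lehner*, Math. Ann. 201 (1973), Thm. 1 (acq-15072 open; witnesses arXiv:0812.0179 p. 48,
  arXiv:0904.2429 p. 8). [Casselman1973]
* H. Carayol, *Sur les représentations ℓ-adiques associées aux formes modulaires de Hilbert*, Ann. Sci. ÉNS 19 (1986), Thm. (A)
  (witness: Cornell–Silverman–Stevens 1997 p. 505, Thm. 6 (2)). [Carayol1986ASENS]
* J.-P. Serre, *Propriétés galoisiennes des points d'ordre fini des courbes elliptiques*, Invent. Math. 15 (1972), §5.6 p. 312. [Serre1972PointsOrdreFini]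
* J. Tate, *Algorithm for determining the type of a singular fiber in an elliptic pencil*, LNM 476 (1975), the table (c_p by Kodaira symbol). [Tate1975Algorithm]
* S. Gelbart, *Automorphic forms on adele groups* (1975), §10 Thm. 10.1–10.2; H. Jacquet, R. P. Langlands, LNM 114 (1970), Thm. 16.1. [Gelbart1975] [JacquetLanglands1970]
* M.-F. Vignéras, *Arithmétique des algèbres de quaternions*, LNM 800 (1980), Ch. III §4 Thm. 4.3, §5 Cor. 5.7. [VignerasLNM800]
* D. Bump, *Automorphic Forms and Representations* (1997), §4.1 (1.6), Lemma/Thm. 4.1.1 p. 406 (held `book:bump1997-automorphic-forms-representations`). [Bump1997]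
-/

set_option autoImplicit false

noncomputable section

namespace Literature.NumberTheory.Automorphic

open scoped MatrixGroups ModularForm
open Literature.RepresentationTheory.FiniteGroups

/-- **The `f_V`-part of the weight-2 forms on the full-level-`q` cover of a Cartan-level Shimura curve, generated by a Cartan-level
`a_ℓ(V)`-eigenform, is isotypic of `SL₂(𝔽_q)`-type `Res Ind_B^{GL₂(𝔽_q)}(χ ⊠ χ⁻¹)`, `χ` cubic, at a Cartan place `q ≡ 1 (3)` with `3 ∣ c_q(V)`.**
Precisely: for a Cartan datum `X : CartanLevelCurveData D M C`, a prime `q ∈ C` with `q % 3 = 1`, the cover order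
`O' = X.O ⊔ (∏_{p ∈ C∖q} p) • X.O₀` (an order: `hO'`) presented as a subring `S` with ANY residue model `red : S →+* M₂(ZMod q)` (surjective,
kernel `q•O'`, `det (red x) = nrd x mod q`), an elliptic, globally minimal `V/ℚ` with `V.conductorNorm ℤ = N = D * M * ∏_{p∈C} p²`, `¬ q³ ∣ N`,
`3 ∣ c_q(V)` (`localTamagawaNumber` of `V/ℚ_q`), and a cusp form `F₀ : CuspForm X.Gamma 2`, `⇑F₀ ≠ 0`, with
`X.heckeFun ℓ F₀ = a_ℓ(V) · F₀` for every prime `ℓ ∤ D·M·∏_{p∈C} p`: there exist `χ : (ZMod q)ˣ →* ℂˣ` with `χ ^ 3 = 1`, `χ ≠ 1`, `k : ℕ` and a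
`ℂ`-linear `Φ : (ℍ → ℂ) →ₗ[ℂ] (Fin k → (GL (Fin 2) (ZMod q) → ℂ))` such that, with `S_F := span_ℂ {⇑F₀ ∣[2] γ : γ ∈ normOneUnits X.ι hO'}`:
(i) `G ∈ S_F`, `Φ G = 0 ⇒ G = 0`; (ii) for `G ∈ S_F` every `Φ G i` lies in the carrier of `GL2.principalSeriesRep (ZMod q) χ χ⁻¹`;
(iii) every `k`-tuple of carrier functions is `Φ G` for some `G ∈ S_F`; (iv) for `G ∈ S_F`, `γ ∈ normOneUnits X.ι hO'`, `x ∈ S` with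
`X.ι x = γ` and `g ∈ GL₂(𝔽_q)` with `↑g = red x`: `Φ (G ∣[2] γ) = fun i y => Φ G i (y * g⁻¹)`.
Sources: Kodaira `IV ∕ IV*` ⟺ `c_q = 3`, `e = 3` [cite: Tate1975Algorithm, the table] [cite: Serre1972PointsOrdreFini, §5.6 p. 312];
local–global compatibility at `q` [cite: Carayol1986ASENS, Thm. (A)]; `K(q)`-invariants of a tame principal series `= I(χ̄₁, χ̄₂)`
[cite: ConradDiamondTaylor1999, Lemma 4.2.4 (2) p. 538] [cite: Casselman1973, Thm. 1]; Jacquet–Langlands + strong multiplicity one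
[cite: Gelbart1975, Thm. 10.1 and Thm. 10.2 (§10)] [cite: JacquetLanglands1970, Thm. 16.1]; strong approximation for `O'¹` and the
adelic–classical dictionary on the cover [cite: VignerasLNM800, Ch. III §4 Thm. 4.3 and §5 Cor. 5.7]; the model and the irreducibility of
`Ind_{B₁}^{SL₂}(ε̄²)` [cite: Bump1997, §4.1 Eq. (1.6) and Thm. 4.1.1 p. 406]; the isotypic-decomposition mechanism of the sibling
[cite: ConradDiamondTaylor1999, §5.3 Lemma 5.3.1 pp. 540–541].  COMPOSITE-SOURCED: no single numbered print states this; it is the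
composite of the cited links (1)–(5) of the module docstring (sibling-class placement, bsd-stepL referee g96 PLACEMENT-FTYPE (c1)).
SCOPE: the `SL₂(𝔽_q)`-type only (what `Γ' ⊂` norm one sees); NOT the `GL₂(𝔽_q)`-type, no multiplicity, nothing at `q ≡ 2 (3)` or `3 ∤ c_q`.
A named fact (D-0014); asserted nowhere. -/
def cartanCoverSpan_isIsotypic_tamePrincipalSeries : Prop :=
  ∀ (D M : ℕ) (C : Finset ℕ) (X : CartanLevelCurveData D M C) (q : ℕ) [Fact q.Prime], q ∈ C → q % 3 = 1 →
    ∀ (hO' : Brandt.IsOrder X.B (X.O ⊔ X.O₀.map ((((∏ p ∈ C.erase q, p : ℕ) : ℤ)) • LinearMap.id)))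
      (S : Subring X.B) (_hS : ∀ x : X.B, x ∈ S ↔ x ∈ X.O ⊔ X.O₀.map ((((∏ p ∈ C.erase q, p : ℕ) : ℤ)) • LinearMap.id))
      (red : S →+* Matrix (Fin 2) (Fin 2) (ZMod q)),
      Function.Surjective red →
      (∀ x : S, red x = 0 ↔ ∃ y ∈ X.O ⊔ X.O₀.map ((((∏ p ∈ C.erase q, p : ℕ) : ℤ)) • LinearMap.id), (x : X.B) = (q : ℤ) • y) →
      (∀ x : S, ∃ n : ℤ, reducedNorm ℚ X.B (x : X.B) = n ∧ (red x).det = (n : ZMod q)) →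
    ∀ (V : WeierstrassCurve ℚ) [V.IsElliptic] [V.IsGloballyMinimal] (N : ℕ),
      V.conductorNorm ℤ = N → D * M * ∏ p ∈ C, p ^ 2 = N → ¬ q ^ 3 ∣ N →
      3 ∣ (V.baseChange ℚ_[q]).localTamagawaNumber ℤ_[q] →
    ∀ F₀ : CuspForm X.Gamma 2, (⇑F₀ : UpperHalfPlane → ℂ) ≠ 0 →
      (∀ ℓ : ℕ, ℓ.Prime → ¬ ℓ ∣ D * M * ∏ p ∈ C, p →
        X.heckeFun ℓ F₀ = fun τ => ((V.LFunction ℓ : ℤ) : ℂ) * F₀ τ) →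
      ∃ (χ : (ZMod q)ˣ →* ℂˣ) (k : ℕ) (Φ : (UpperHalfPlane → ℂ) →ₗ[ℂ] (Fin k → (GL (Fin 2) (ZMod q) → ℂ))),
        χ ^ 3 = 1 ∧ χ ≠ 1 ∧
        (∀ G ∈ Submodule.span ℂ (Set.range fun γ : normOneUnits X.ι hO' =>
            (⇑F₀ : UpperHalfPlane → ℂ) ∣[(2 : ℤ)] ((γ : GL (Fin 2) ℝ))), Φ G = 0 → G = 0) ∧
        (∀ G ∈ Submodule.span ℂ (Set.range fun γ : normOneUnits X.ι hO' =>
            (⇑F₀ : UpperHalfPlane → ℂ) ∣[(2 : ℤ)] ((γ : GL (Fin 2) ℝ))), ∀ i : Fin k,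
            Φ G i ∈ Representation.coindV (GL2.borel (ZMod q)).subtype
              (scalarRep (GL2.borelCharacter (ZMod q) χ χ⁻¹))) ∧
        (∀ f : Fin k → (GL (Fin 2) (ZMod q) → ℂ),
          (∀ i, f i ∈ Representation.coindV (GL2.borel (ZMod q)).subtype
              (scalarRep (GL2.borelCharacter (ZMod q) χ χ⁻¹))) →
          ∃ G ∈ Submodule.span ℂ (Set.range fun γ : normOneUnits X.ι hO' =>
            (⇑F₀ : UpperHalfPlane → ℂ) ∣[(2 : ℤ)] ((γ : GL (Fin 2) ℝ))), Φ G = f) ∧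
        (∀ G ∈ Submodule.span ℂ (Set.range fun γ : normOneUnits X.ι hO' =>
            (⇑F₀ : UpperHalfPlane → ℂ) ∣[(2 : ℤ)] ((γ : GL (Fin 2) ℝ))),
          ∀ (γ : normOneUnits X.ι hO') (x : S) (g : GL (Fin 2) (ZMod q)),
            X.ι (x : X.B) = ((γ : GL (Fin 2) ℝ) : Matrix (Fin 2) (Fin 2) ℝ) →
            ((g : GL (Fin 2) (ZMod q)) : Matrix (Fin 2) (Fin 2) (ZMod q)) = red x →
            Φ (G ∣[(2 : ℤ)] ((γ : GL (Fin 2) ℝ))) = fun i y => Φ G i (y * g⁻¹))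

end Literature.NumberTheory.Automorphic

end
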